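import Summits.Ventures.PercRepro.C026HGraph

/-!
# 3-terminal gluings of marked multigraphs: definitions and the no-mixing lemmas (p6, gen 8)

mine-3's composition theorem (`proofs/MINE3-Q3-proof.md` §26.8–§26.9): a marked multigraph `G` whose
edges are two-coloured by `side : E → Bool` so that every vertex other than the marks `a, b, c` carries
edges of ONE colour only is the gluing at the marks of its two parts `G.part side true` and
`G.part side false`.  This file has the definitions and the connectivity dictionary of a gluing:

* `IsGluing G a b c side`; the parts `G.part side s` (same vertex type, edge subtype); the restriction
  `sideRestrict ω side s` of a configuration; the product bijection
  `sideEquiv side : Config E ≃ Config {e // side e = true} × Config {e // side e = false}`;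
* `EdgeAt`, `HasCol` (a vertex carries an edge of colour `s`) and `IsGluing.col_eq`: a non-mark has
  ONE colour; `hasCol_of_conn_part`: a nontrivial path of colour `s` gives its endpoint an edge of
  colour `s`;
* **the no-mixing lemma** `conn_iff_exists_part`: if no part joins `u` to a mark other than `u`, then
  `G` joins `u` to `v` iff ONE part does (a walk changes colour only at the marks);
* (L0a) `conn_mark_iff` — under `IsBot` the clusters of the marks split by colour; (L0b)
  `conn_rest_iff` — a vertex outside the marks' clusters is joined to `v` iff one part joins it;
  (L1) `isBot_gluing_iff`; (L2) `mem_cluster_mark_iff`, `mem_cluster_part_of_hasCol`.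
-/

namespace PercRepro

/-- The restriction of a configuration to the edges of colour `s`. -/
def sideRestrict {E : Type*} (ω : Config E) (side : E → Bool) (s : Bool) :
    Config {e // side e = s} :=
  fun e => ω e.1

/-- Restriction is the coordinate projection. -/
@[simp] theorem sideRestrict_apply {E : Type*} (ω : Config E) (side : E → Bool) (s : Bool)
    (e : {e // side e = s}) : sideRestrict ω side s e = ω e.1 := rfl

/-- **The product bijection** of a two-colouring: a configuration is the pair of its two restrictions. -/
def sideEquiv {E : Type*} (side : E → Bool) :
    Config E ≃ Config {e // side e = true} × Config {e // side e = false} where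
  toFun ω := (sideRestrict ω side true, sideRestrict ω side false)
  invFun q e := if h : side e = true then q.1 ⟨e, h⟩ else q.2 ⟨e, by simpa using h⟩
  left_inv ω := by
    funext e
    by_cases h : side e = true
    · simp [sideRestrict, h]
    · simp [sideRestrict, h]
  right_inv q := by
    refine Prod.ext ?_ ?_
    · funext e
      simp [sideRestrict, e.2]
    · funext e
      have he : side e.1 = false := e.2
      simp [sideRestrict, he]

/-- The first restriction of the inverse image of a pair is its first component. -/
@[simp] theorem sideRestrict_symm_true {E : Type*} (side : E → Bool)
    (q : Config {e // side e = true} × Config {e // side e = false}) :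
    sideRestrict ((sideEquiv side).symm q) side true = q.1 :=
  congrArg Prod.fst ((sideEquiv side).apply_symm_apply q)

/-- The second restriction of the inverse image of a pair is its second component. -/
@[simp] theorem sideRestrict_symm_false {E : Type*} (side : E → Bool)
    (q : Config {e // side e = true} × Config {e // side e = false}) :
    sideRestrict ((sideEquiv side).symm q) side false = q.2 :=
  congrArg Prod.snd ((sideEquiv side).apply_symm_apply q)

namespace MultiGraph

section Gluing

variable {V E : Type*} (G : MultiGraph V E)

/-- The edge `e` is at the vertex `v`. -/
def EdgeAt (e : E) (v : V) : Prop := G.fst e = v ∨ G.snd e = v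

/-- The vertex `v` carries an edge of colour `s`. -/
def HasCol (side : E → Bool) (s : Bool) (v : V) : Prop := ∃ e, side e = s ∧ G.EdgeAt e v

/-- **A 3-terminal gluing**: the edges are two-coloured by `side`, and every vertex other than the
marks `a, b, c` is incident to edges of one colour only. -/
def IsGluing (a b c : V) (side : E → Bool) : Prop :=
  ∀ v, v ≠ a → v ≠ b → v ≠ c → ∀ e e', (G.fst e = v ∨ G.snd e = v) →
    (G.fst e' = v ∨ G.snd e' = v) → side e = side e'

/-- The part of colour `s`: the same vertices, the edges of colour `s` (the other part's non-marks
become isolated vertices, which affect no count). -/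
def part (side : E → Bool) (s : Bool) : MultiGraph V {e // side e = s} :=
  ⟨fun e => G.fst e.1, fun e => G.snd e.1⟩

/-- The endpoints of an edge of a part. -/
@[simp] theorem part_fst (side : E → Bool) (s : Bool) (e : {e // side e = s}) :
    (G.part side s).fst e = G.fst e.1 := rfl

/-- The endpoints of an edge of a part. -/
@[simp] theorem part_snd (side : E → Bool) (s : Bool) (e : {e // side e = s}) :
    (G.part side s).snd e = G.snd e.1 := rfl

variable {G}

/-- An edge joining `x` and `y` is at `x`. -/
theorem EdgeAt.of_joins_left {e : E} {x y : V} (h : G.Joins e x y) : G.EdgeAt e x := by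
  rcases h with ⟨h1, _⟩ | ⟨_, h2⟩
  · exact Or.inl h1
  · exact Or.inr h2

/-- An edge joining `x` and `y` is at `y`. -/
theorem EdgeAt.of_joins_right {e : E} {x y : V} (h : G.Joins e x y) : G.EdgeAt e y := by
  rcases h with ⟨_, h2⟩ | ⟨h1, _⟩
  · exact Or.inr h2
  · exact Or.inl h1

/-- An edge joining `x` and `y` gives both its colour. -/
theorem HasCol.of_joins {side : E → Bool} {e : E} {x y : V} (h : G.Joins e x y) :
    G.HasCol side (side e) x ∧ G.HasCol side (side e) y :=
  ⟨⟨e, rfl, EdgeAt.of_joins_left h⟩, ⟨e, rfl, EdgeAt.of_joins_right h⟩⟩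

/-- **A non-mark has one colour**: two edges at a vertex other than the marks have the same colour. -/
theorem IsGluing.col_eq {a b c : V} {side : E → Bool} (hg : G.IsGluing a b c side) {v : V}
    (hva : v ≠ a) (hvb : v ≠ b) (hvc : v ≠ c) {e e' : E} (he : G.EdgeAt e v) (he' : G.EdgeAt e' v) :
    side e = side e' :=
  hg v hva hvb hvc e e' he he'

/-- **A non-mark has one colour** (`HasCol` form). -/
theorem IsGluing.eq_of_hasCol {a b c : V} {side : E → Bool} (hg : G.IsGluing a b c side) {v : V}
    (hva : v ≠ a) (hvb : v ≠ b) (hvc : v ≠ c) {s s' : Bool} (hs : G.HasCol side s v)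
    (hs' : G.HasCol side s' v) : s = s' := by
  obtain ⟨e, rfl, he⟩ := hs
  obtain ⟨e', rfl, he'⟩ := hs'
  exact hg.col_eq hva hvb hvc he he'

/-- An open step of a part is an open step of `G`. -/
theorem OpenAdj.of_part {side : E → Bool} {s : Bool} {ω : Config E} {u v : V}
    (h : (G.part side s).OpenAdj (sideRestrict ω side s) u v) : G.OpenAdj ω u v := by
  obtain ⟨e, he, hend⟩ := h
  exact ⟨e.1, he, hend⟩

/-- Connectivity in a part is connectivity in `G`. -/
theorem Conn.of_part {side : E → Bool} {s : Bool} {ω : Config E} {u v : V}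
    (h : (G.part side s).Conn (sideRestrict ω side s) u v) : G.Conn ω u v := by
  unfold Conn at h ⊢
  induction h with
  | refl => exact Relation.ReflTransGen.refl
  | tail _ hxy ih => exact ih.tail (OpenAdj.of_part hxy)

/-- The cluster of a vertex in a part is contained in its cluster in `G`. -/
theorem cluster_part_subset (side : E → Bool) (s : Bool) (ω : Config E) (v : V) :
    (G.part side s).cluster (sideRestrict ω side s) v ⊆ G.cluster ω v :=
  fun _ h => Conn.of_part h

/-- An open edge of `G` of colour `s` is an open step of the part of colour `s`. -/
theorem openAdj_part_of_open {side : E → Bool} {ω : Config E} {e : E} {u v : V} (he : ω e = true)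
    (hj : G.Joins e u v) : (G.part side (side e)).OpenAdj (sideRestrict ω side (side e)) u v :=
  ⟨⟨e, rfl⟩, he, hj⟩

/-- **A nontrivial path of colour `s` ending at `v` gives `v` an edge of colour `s`.** -/
theorem hasCol_of_conn_part {side : E → Bool} {s : Bool} {ω : Config E} {u v : V}
    (h : (G.part side s).Conn (sideRestrict ω side s) u v) (hne : v ≠ u) : G.HasCol side s v := by
  rcases Relation.ReflTransGen.cases_tail h with h | ⟨x, _, hxv⟩
  · exact absurd h hne
  · obtain ⟨e, _, hend⟩ := hxv
    exact ⟨e.1, e.2, EdgeAt.of_joins_right hend⟩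

/-- **The no-mixing lemma**: if no part joins `u` to a mark other than `u`, then `G` joins `u` to `v`
iff ONE part does — a walk from `u` changes colour only at a mark, and the only mark it can reach is
`u` itself. -/
theorem conn_iff_exists_part {a b c : V} {side : E → Bool} (hg : G.IsGluing a b c side)
    {ω : Config E} {u : V}
    (hmk : ∀ x, x ≠ u → (x = a ∨ x = b ∨ x = c) →
      ∀ s, ¬ (G.part side s).Conn (sideRestrict ω side s) u x) (v : V) :
    G.Conn ω u v ↔ ∃ s, (G.part side s).Conn (sideRestrict ω side s) u v := by
  constructor
  · intro h
    refine Conn.induction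
      (motive := fun x => ∃ s, (G.part side s).Conn (sideRestrict ω side s) u x)
      ⟨true, Conn.refl _ _ _⟩ ?_ h
    intro x y _ hxy hx
    obtain ⟨s, hsx⟩ := hx
    obtain ⟨e, he, hend⟩ := hxy
    have hj : G.Joins e x y := hend
    by_cases hxu : x = u
    · subst hxu
      exact ⟨side e, Conn.of_openAdj (openAdj_part_of_open he hj)⟩
    · -- `x` is a non-mark, so its colour is the colour `s` of the path reaching it
      have hx : ¬ (x = a ∨ x = b ∨ x = c) := fun hm => hmk x hxu hm s hsx
      push Not at hx
      have hcol : side e = s :=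
        hg.eq_of_hasCol hx.1 hx.2.1 hx.2.2 (HasCol.of_joins (side := side) hj).1
          (hasCol_of_conn_part hsx hxu)
      exact ⟨s, hsx.tail ⟨⟨e, hcol⟩, he, hj⟩⟩
  · rintro ⟨s, h⟩
    exact Conn.of_part h

/-- Two distinct marks are not joined under `IsBot`. -/
theorem IsBot.not_conn_mark {ω : Config E} {a b c : V} (hb : G.IsBot ω a b c) {m x : V}
    (hm : m = a ∨ m = b ∨ m = c) (hx : x = a ∨ x = b ∨ x = c) (hne : m ≠ x) :
    ¬ G.Conn ω m x := by
  obtain ⟨hab, hac, hbc⟩ := hb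
  rcases hm with rfl | rfl | rfl <;> rcases hx with rfl | rfl | rfl
  · exact absurd rfl hne
  · exact hab
  · exact hac
  · exact fun h => hab h.symm
  · exact absurd rfl hne
  · exact hbc
  · exact fun h => hac h.symm
  · exact fun h => hbc h.symm
  · exact absurd rfl hne

/-- A mark is in no other mark's cluster under `IsBot`. -/
theorem IsBot.not_mem_cluster_mark {ω : Config E} {a b c : V} (hb : G.IsBot ω a b c) {m x : V}
    (hm : m = a ∨ m = b ∨ m = c) (hx : x = a ∨ x = b ∨ x = c) (hne : m ≠ x) :
    x ∉ G.cluster ω m :=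
  hb.not_conn_mark hm hx hne

/-- **(L0a)** Under `IsBot`, `G` joins the mark `m` to `v` iff one part does. -/
theorem conn_mark_iff {a b c : V} {side : E → Bool} (hg : G.IsGluing a b c side) {ω : Config E}
    (hb : G.IsBot ω a b c) {m : V} (hm : m = a ∨ m = b ∨ m = c) (v : V) :
    G.Conn ω m v ↔ ∃ s, (G.part side s).Conn (sideRestrict ω side s) m v := by
  refine conn_iff_exists_part hg ?_ v
  intro x hxm hx s hs
  exact hb.not_conn_mark hm hx (Ne.symm hxm) (Conn.of_part hs)

/-- **(L2)** Under `IsBot`, the cluster of a mark is the union of its clusters in the two parts. -/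
theorem mem_cluster_mark_iff {a b c : V} {side : E → Bool} (hg : G.IsGluing a b c side)
    {ω : Config E} (hb : G.IsBot ω a b c) {m : V} (hm : m = a ∨ m = b ∨ m = c) (v : V) :
    v ∈ G.cluster ω m ↔
      v ∈ (G.part side true).cluster (sideRestrict ω side true) m ∨
        v ∈ (G.part side false).cluster (sideRestrict ω side false) m := by
  rw [mem_cluster, conn_mark_iff hg hb hm, Bool.exists_bool]
  exact Or.comm

/-- **(L0b)** A vertex `u` outside the marks' clusters is joined to `v` in `G` iff one part joins it. -/
theorem conn_rest_iff {a b c : V} {side : E → Bool} (hg : G.IsGluing a b c side) {ω : Config E}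
    {u : V} (hu : ∀ m, (m = a ∨ m = b ∨ m = c) → ¬ G.Conn ω m u) (v : V) :
    G.Conn ω u v ↔ ∃ s, (G.part side s).Conn (sideRestrict ω side s) u v := by
  refine conn_iff_exists_part hg ?_ v
  intro x _ hx s hs
  exact hu x hx (Conn.of_part hs).symm

/-- **(L1)** A configuration is `bot` for `G` iff its restrictions are `bot` for the two parts. -/
theorem isBot_gluing_iff {a b c : V} {side : E → Bool} (hg : G.IsGluing a b c side)
    (ω : Config E) :
    G.IsBot ω a b c ↔
      (G.part side true).IsBot (sideRestrict ω side true) a b c ∧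
        (G.part side false).IsBot (sideRestrict ω side false) a b c := by
  constructor
  · rintro ⟨hab, hac, hbc⟩
    exact ⟨⟨fun h => hab (Conn.of_part h), fun h => hac (Conn.of_part h),
      fun h => hbc (Conn.of_part h)⟩, ⟨fun h => hab (Conn.of_part h),
      fun h => hac (Conn.of_part h), fun h => hbc (Conn.of_part h)⟩⟩
  · rintro ⟨h₁, h₀⟩
    -- no part joins a mark to another mark
    have key : ∀ {m : V}, (m = a ∨ m = b ∨ m = c) → ∀ x, x ≠ m → (x = a ∨ x = b ∨ x = c) →
        ∀ s, ¬ (G.part side s).Conn (sideRestrict ω side s) m x := by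
      intro m hm x hxm hx s
      cases s
      · exact h₀.not_conn_mark hm hx (Ne.symm hxm)
      · exact h₁.not_conn_mark hm hx (Ne.symm hxm)
    refine ⟨fun h => ?_, fun h => ?_, fun h => ?_⟩
    · obtain ⟨s, hs⟩ := (conn_iff_exists_part hg (key (Or.inl rfl)) b).mp h
      cases s
      · exact h₀.1 hs
      · exact h₁.1 hs
    · obtain ⟨s, hs⟩ := (conn_iff_exists_part hg (key (Or.inl rfl)) c).mp h
      cases s
      · exact h₀.2.1 hs
      · exact h₁.2.1 hs
    · obtain ⟨s, hs⟩ := (conn_iff_exists_part hg (key (Or.inr (Or.inl rfl))) c).mp h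
      cases s
      · exact h₀.2.2 hs
      · exact h₁.2.2 hs

/-- **(L2, colour form)** Under `IsBot`, a vertex carrying an edge of colour `s` that lies in the
cluster of the mark `m` lies in the cluster of `m` in the part of colour `s`. -/
theorem mem_cluster_part_of_hasCol {a b c : V} {side : E → Bool} (hg : G.IsGluing a b c side)
    {ω : Config E} (hb : G.IsBot ω a b c) {m : V} (hm : m = a ∨ m = b ∨ m = c) {s : Bool} {v : V}
    (hv : G.HasCol side s v) (hvm : v ∈ G.cluster ω m) :
    v ∈ (G.part side s).cluster (sideRestrict ω side s) m := by
  obtain ⟨s', hs'⟩ := (conn_mark_iff hg hb hm v).mp hvm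
  by_cases hvm' : v = m
  · subst hvm'
    exact Conn.refl _ _ _
  · -- `v` is a non-mark of colour `s'`, hence `s' = s`
    have hv' : G.HasCol side s' v := hasCol_of_conn_part hs' hvm'
    have hnm : v ≠ a ∧ v ≠ b ∧ v ≠ c :=
      ⟨fun h => hb.not_conn_mark hm (Or.inl h) (Ne.symm hvm') hvm,
        fun h => hb.not_conn_mark hm (Or.inr (Or.inl h)) (Ne.symm hvm') hvm,
        fun h => hb.not_conn_mark hm (Or.inr (Or.inr h)) (Ne.symm hvm') hvm⟩
    have : s' = s := hg.eq_of_hasCol hnm.1 hnm.2.1 hnm.2.2 hv' hv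
    subst this
    exact hs'

/-- **(L2, contrapositive)** Under `IsBot`, a vertex carrying an edge of colour `s` outside the cluster
of the mark `m` in the part of colour `s` is outside the cluster of `m` in `G`. -/
theorem not_mem_cluster_of_hasCol {a b c : V} {side : E → Bool} (hg : G.IsGluing a b c side)
    {ω : Config E} (hb : G.IsBot ω a b c) {m : V} (hm : m = a ∨ m = b ∨ m = c) {s : Bool} {v : V}
    (hv : G.HasCol side s v) (hvm : v ∉ (G.part side s).cluster (sideRestrict ω side s) m) :
    v ∉ G.cluster ω m :=
  fun h => hvm (mem_cluster_part_of_hasCol hg hb hm hv h)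

/-- Under `IsBot`, a vertex carrying an edge of colour `s` is in `M = Com_c(S)` iff it is in the
cluster of `c` of the part of colour `s`. -/
theorem mem_clusterC_iff_of_hasCol {a b c : V} {side : E → Bool} (hg : G.IsGluing a b c side)
    {ω : Config E} (hb : G.IsBot ω a b c) {s : Bool} {v : V} (hv : G.HasCol side s v) :
    v ∈ G.cluster ω c ↔ v ∈ (G.part side s).cluster (sideRestrict ω side s) c :=
  ⟨mem_cluster_part_of_hasCol hg hb (Or.inr (Or.inr rfl)) hv, fun h => cluster_part_subset _ _ _ _ h⟩

end Gluing

end MultiGraph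

end PercRepro
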